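import Literature.NumberTheory.Transcendental.ZilberCategoricity
import Literature.NumberTheory.Transcendental.EclExchangeProofs
import Literature.NumberTheory.Transcendental.ZilberFieldTransport
import HarnessLib

/-!
# The class of Zilber fields: the elementary axioms of a quasiminimal pregeometry class, proved

`ZilberCategoricity.lean` reduces Zilber's categoricity theorem
(`Literature.NumberTheory.Transcendental.zilber_categoricity`) to two printed halves, the second
being that the class `ZilberClass` of Zilber fields (models of `ECF_{SK,CCP}`) with Kirby's
closure `ecl`, in the closure-isomorphism language `Language.eclIso`, is a quasiminimal
pregeometry class in the sense of Haykazyan 2016, Def. 2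
(`Literature.ModelTheory.Quasiminimal.IsQuasiminimalPregeometryClass`; Bays–Kirby 2013, Props 4–5
= Kirby 2010, axioms 0, I, II for this class). This file PROVES the elementary clauses of that
statement, so that only the deep ones remain (the quantifier-free theory = uniqueness of
`ecl(∅)`; closed subsets are models; `ℵ₀`-homogeneity over `∅` and over countable closed
subsets across two Zilber fields):

* axiom (3i): `ecl` is a pregeometry with the countable closure property in every member
  (`isPregeometry_ecl` — Kirby, Bull. LMS 42 (2010), Thm 1.1, assembled from the tree's
  discharges `Kirby2010_ecl_exchange_holds`, `…_finiteCharacter_holds`, `Khovanskii.ecl_ecl`;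
  `ZilberClass.isPregeometry`, `ZilberClass.countable_cl`);
* axiom (3iii): the closure is determined by partial embeddings
  (`ZilberClass.mem_cl_iff_of_isPartialEmbOn` — Kirby 2010 (QMEC), axiom I.3 / Lemma 1.3 for
  Zilber fields: a partial `Language.eclIso`-embedding on `X ∪ {y}` gives isomorphisms of the
  closures of its finite sub-tuples, `exists_eHom_of_eqQFType₂`, and these carry `ecl`-dependence,
  `ecl_range_comp_eHom`);
* axiom (1): closure under isomorphisms (`ZilberClass.of_equiv` — transport of the exponential
  field structure, of Zilber's axioms (`IsZilberField.of_exponentialRingEquiv`,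
  `ZilberFieldTransport.lean`), of the canonical `Language.eclIso`-structure and of `ecl` along an
  `Language.eclIso`-isomorphism).

* the dictionary "partial embeddings between `ecl`-closed sets = isomorphisms of exponential
  fields" (`isPartialEmbOn_ecl_of_eHom`, with `exists_eHom_of_eqQFType₂` / `eqQFType₂_of_eHom` of
  `ZilberCategoricity.lean`), whence axiom (4ii) over `∅` (`exists_eqQFType₂_snoc_of_mem_ecl`:
  inside a closure the matching isomorphism already provides the partner), and the reductions of
  axiom (3ii) to "ecl-closed E-subfields of Zilber fields are Zilber fields"
  (`zilberClass_eclSubstructure`, `ZilberClass.cl_mem_of`), of axiom (2) to "the `ecl(∅)`'s of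
  two Zilber fields are isomorphic" (`ZilberClass.eqQFType₂_elim0_of`), and of axiom (4i) over `∅`
  to (2) + (4i) over closed sets (`ZilberClass.eqQFType₂_of_notMem_cl_empty_of`).

Finally `ZilberClass.isQuasiminimalPregeometryClass_of` assembles the class axioms from the proved
clauses and the deep ones taken as hypotheses — uniqueness of `ecl(∅)`, closed E-subfields are
Zilber fields, and the two clauses of `ℵ₀`-homogeneity over countable closed subsets across two
Zilber fields — which is exactly what remains to be proved of the second half of the categoricity
proof. Everything here is proved; no named fact is introduced.

## References

* L. Haykazyan, *Categoricity in quasiminimal pregeometry classes*, J. Symbolic Logic 81 (2016),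
  Def. 2.
* J. Kirby, *On quasiminimal excellent classes*, J. Symbolic Logic 75 (2010), Def. 1.1 (axiom I),
  Lemma 1.3.
* J. Kirby, *Exponential algebraicity in exponential fields*, Bull. LMS 42 (2010), Thm 1.1,
  Lemma 3.3.
* M. Bays, J. Kirby, *Excellence and uncountable categoricity of Zilber's exponential fields*,
  arXiv:1305.0493 (2013), Prop. 4.
-/

noncomputable section

open Set
open FirstOrder FirstOrder.Language
open Literature.ModelTheory.ExponentialFields Literature.ModelTheory.Quasiminimal

namespace Literature.NumberTheory.Transcendental

/-! ### Axiom (3i): `ecl` is a pregeometry with the countable closure property -/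

/-- **`ecl` is a pregeometry** on every exponential field (Kirby 2010 (EAEF), Thm 1.1: a closure
operator (Lemma 3.3: `subset_ecl`, `ecl_mono`, `Khovanskii.ecl_ecl`) of finite character
(`Kirby2010_ecl_finiteCharacter_holds`) with Steinitz exchange (`Kirby2010_ecl_exchange_holds`), all
discharged in the tree; compare `SEACModel.isPregeometry_ecl_union` of `SEACOrbits.lean`, the
localised version). [cite: Kirby2010, Thm. 1.1] -/
theorem isPregeometry_ecl (K : Type*) [Field K] [ExponentialRing K] :
    IsPregeometry (ecl : Set K → Set K) where
  subset_cl A := subset_ecl A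
  mono _ _ h := ecl_mono h
  cl_cl A := Khovanskii.ecl_ecl A
  finite_character := by
    intro A a ha
    obtain ⟨C₀, hC₀, haC₀⟩ := (Kirby2010_ecl_finiteCharacter_holds K).exists_finset (C := A) ha
    exact ⟨↑C₀, hC₀, C₀.finite_toSet, haC₀⟩
  exchange := fun A a b hab ha => Kirby2010_ecl_exchange_holds (K := K) A a b hab ha

section Members

variable {H : Type} [Language.eclIso.Structure H] {cl : Set H → Set H}

/-- Axiom (3i) for the class of Zilber fields, pregeometry part: the closure of a member is a
pregeometry. [cite: Kirby2010, Thm. 1.1] -/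
theorem ZilberClass.isPregeometry (hH : ZilberClass H cl) : IsPregeometry cl := by
  obtain ⟨iF, _, iE, -, -, rfl⟩ := hH
  exact isPregeometry_ecl H

/-- Axiom (3i) for the class of Zilber fields, countable closure part: closures of finite sets are
countable (axiom CCP of `IsZilberField`, stated in the tree for countable sets).
[cite: BaysKirby2018ANT, Thm 9.1 (axiom 5)] -/
theorem ZilberClass.countable_cl (hH : ZilberClass H cl) (A : Set H) (hA : A.Finite) :
    (cl A).Countable := by
  obtain ⟨iF, _, iE, hZ, -, rfl⟩ := hH
  exact hZ.hasCountableClosureProperty A hA.countable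

end Members

/-! ### Axiom (3iii): the closure is determined by partial embeddings -/

section ClosureDetermined

variable {K : Type} [Field K] [ExponentialRing K] {K' : Type*} [Field K'] [ExponentialRing K']

/-- **Partial `Language.eclIso`-embeddings carry `ecl`-dependence** (one direction of Kirby 2010,
axiom I.3, for exponential fields): if `f` is a partial embedding on `range b ∪ {y}` and
`y ∈ ecl (range b)` then `f y ∈ ecl (range (f ∘ b))`; and conversely. The matched tuples
`(b, y) ↦ (f b, f y)` have the same quantifier-free type, so there is an isomorphism of
exponential fields `ecl(b, y) ≅ ecl(f b, f y)` over it (`exists_eHom_of_eqQFType₂`), which maps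
`ecl(b)` onto `ecl(f b)` (`ecl_range_comp_eHom`). [cite: Kirby2010QMEC, Lemma 1.3] -/
theorem mem_ecl_range_iff_of_eqQFType₂_snoc {n : ℕ} {b : Fin n → K} {b' : Fin n → K'} {y : K}
    {y' : K'} (h : Language.eclIso.EqQFType₂ (Fin.snoc b y : Fin (n + 1) → K) (Fin.snoc b' y')) :
    y ∈ ecl (Set.range b) ↔ y' ∈ ecl (Set.range b') := by
  set t : Fin (n + 1) → K := Fin.snoc b y with ht
  set t' : Fin (n + 1) → K' := Fin.snoc b' y' with ht'
  obtain ⟨φ, hφ, hφt⟩ := exists_eHom_of_eqQFType₂ h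
  have hφinj : Function.Injective φ := φ.toRingHom.injective
  -- the tuple `b` and the point `y` inside the E-subfield `ecl(t)`
  have hbt : ∀ i, b i ∈ ecl (Set.range t) := fun i =>
    subset_ecl _ ⟨Fin.castSucc i, by simp [ht]⟩
  have hyt : y ∈ ecl (Set.range t) := subset_ecl _ ⟨Fin.last n, by simp [ht]⟩
  let b₀ : Fin n → Khovanskii.eclSubfield (Set.range t) := fun i => ⟨b i, hbt i⟩
  let y₀ : Khovanskii.eclSubfield (Set.range t) := ⟨y, hyt⟩
  have hb : Subtype.val ∘ b₀ = b := funext fun i => rfl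
  have hφb : ⇑φ ∘ b₀ = b' := funext fun i => by
    have := hφt (Fin.castSucc i)
    simp only [ht, ht', Fin.snoc_castSucc] at this
    exact this
  have hφy : φ y₀ = y' := by
    have := hφt (Fin.last n)
    simp only [ht, ht', Fin.snoc_last] at this
    exact this
  have hK := ecl_range_comp_val b₀
  have hK' := ecl_range_comp_eHom φ hφ b₀
  rw [hb] at hK
  rw [hφb] at hK'
  constructor
  · intro hy
    rw [hK] at hy
    obtain ⟨c, hc, hcy⟩ := hy
    have : c = y₀ := Subtype.ext hcy
    subst this
    rw [hK', ← hφy]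
    exact ⟨y₀, hc, rfl⟩
  · intro hy'
    rw [hK', ← hφy] at hy'
    obtain ⟨c, hc, hcy⟩ := hy'
    have : c = y₀ := hφinj hcy
    subst this
    rw [hK]
    exact ⟨y₀, hc, rfl⟩

end ClosureDetermined

section Members

variable {H H' : Type} [Language.eclIso.Structure H] [Language.eclIso.Structure H']
  {cl : Set H → Set H} {cl' : Set H' → Set H'}

/-- **Axiom (3iii) for the class of Zilber fields** (Kirby 2010, axiom I.3; Haykazyan 2016,
Def. 2: the closure is determined by partial embeddings): if `f : H ⇀ H'` is a partial
`Language.eclIso`-embedding defined on `X ∪ {y}` between two members, then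
`y ∈ cl X ↔ f y ∈ cl' (f X)`. By finite character one reduces to a finite `X₀ ⊆ X`, where it is
`mem_ecl_range_iff_of_eqQFType₂_snoc`. [cite: Kirby2010QMEC, Def. 1.1 (axiom I.3) and Lemma 1.3] -/
theorem ZilberClass.mem_cl_iff_of_isPartialEmbOn (hH : ZilberClass H cl) (hH' : ZilberClass H' cl')
    (X : Set H) (y : H) (f : H → H') (hf : IsPartialEmbOn Language.eclIso f (insert y X)) :
    y ∈ cl X ↔ f y ∈ cl' (f '' X) := by
  obtain ⟨iF, _, iE, -, rfl, rfl⟩ := hH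
  obtain ⟨iF', _, iE', -, rfl, rfl⟩ := hH'
  have hP := isPregeometry_ecl H
  have hP' := isPregeometry_ecl H'
  -- for a finite `X₀ ⊆ X` enumerated by `b`, the matched tuples `(b, y) ↦ (f b, f y)`
  have key : ∀ {n : ℕ} (b : Fin n → H), Set.range b ⊆ X →
      (y ∈ ecl (Set.range b) ↔ f y ∈ ecl (Set.range (f ∘ b))) := by
    intro n b hb
    refine mem_ecl_range_iff_of_eqQFType₂_snoc ?_
    have hmem : ∀ i, (Fin.snoc b y : Fin (n + 1) → H) i ∈ insert y X := fun i => by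
      refine Fin.lastCases ?_ (fun j => ?_) i
      · simp
      · simpa using Or.inr (hb ⟨j, rfl⟩)
    have := hf _ hmem
    have e : f ∘ (Fin.snoc b y : Fin (n + 1) → H) = Fin.snoc (f ∘ b) (f y) := by
      funext i
      refine Fin.lastCases ?_ (fun j => ?_) i <;> simp
    rwa [e] at this
  constructor
  · intro hy
    obtain ⟨X₀, hX₀X, hX₀fin, hyX₀⟩ := hP.finite_character hy
    obtain ⟨n, b, hb⟩ := hX₀fin.fin_embedding
    have hy' : y ∈ ecl (Set.range b) := by rw [hb]; exact hyX₀
    have := (key b (hb ▸ hX₀X)).1 hy'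
    refine hP'.mono ?_ this
    rw [Set.range_comp]
    exact Set.image_mono (hb ▸ hX₀X)
  · intro hy
    obtain ⟨Y₀, hY₀, hY₀fin, hyY₀⟩ := hP'.finite_character hy
    -- choose preimages in `X`
    have : ∀ z : Y₀, ∃ x ∈ X, f x = z := fun z => hY₀ z.2
    choose g hgX hgf using this
    haveI : Finite Y₀ := hY₀fin.to_subtype
    obtain ⟨n, ⟨e⟩⟩ := Finite.exists_equiv_fin Y₀
    let b : Fin n → H := fun i => g (e.symm i)
    have hbX : Set.range b ⊆ X := by rintro _ ⟨i, rfl⟩; exact hgX _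
    have hfb : Set.range (f ∘ b) = Y₀ := by
      ext z
      simp only [Set.mem_range, Function.comp_apply, b]
      constructor
      · rintro ⟨i, rfl⟩; rw [hgf]; exact (e.symm i).2
      · intro hz; exact ⟨e ⟨z, hz⟩, by rw [e.symm_apply_apply, hgf]⟩
    have hy' : f y ∈ ecl (Set.range (f ∘ b)) := by rw [hfb]; exact hyY₀
    have := (key b hbX).2 hy'
    exact hP.mono hbX this

end Members

/-! ### Axiom (1): closure under isomorphisms -/

section Transport

/-- Two `L`-structures on the same type with the same interpretations are equal. [folklore] -/
theorem structure_ext {L : Language} {M : Type*} {s₁ s₂ : L.Structure M}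
    (hf : ∀ {n : ℕ} (f : L.Functions n) (v : Fin n → M),
      @Structure.funMap L M s₁ n f v = @Structure.funMap L M s₂ n f v)
    (hr : ∀ {n : ℕ} (R : L.Relations n) (v : Fin n → M),
      @Structure.RelMap L M s₁ n R v ↔ @Structure.RelMap L M s₂ n R v) : s₁ = s₂ := by
  cases s₁ with
  | mk f₁ r₁ =>
    cases s₂ with
    | mk f₂ r₂ =>
      have h1 : @f₁ = @f₂ := by
        funext n f v
        exact hf f v
      have h2 : @r₁ = @r₂ := by
        funext n R v
        exact propext (hr R v)
      cases h1
      cases h2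
      rfl

variable {K : Type} [Field K] [CharZero K] [ExponentialRing K]
  {H' : Type} [Language.eclIso.Structure H']

/-- **Transport of a Zilber field along a `Language.eclIso`-isomorphism**: if `K` is a Zilber
field and `e : K ≃ H'` is an isomorphism onto an arbitrary `Language.eclIso`-structure `H'`, then
`H'` — with the field structure, the exponential and the closure `X' ↦ e(ecl(e⁻¹ X'))` transported
along `e` — is in the class of Zilber fields: the transported `K ≃ H'` is an isomorphism of
exponential fields, Zilber's axioms are invariant (`IsZilberField.of_exponentialRingEquiv`), the
given structure on `H'` is the canonical one of the transported exponential field (function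
symbols by `e.map_fun`, relation symbols by `e.map_rel` and `Khovanskii.image_ecl_equiv`), and the
transported closure is `ecl` (`Khovanskii.image_ecl_equiv`). This is axiom (1) of Haykazyan's
Def. 2 (closure under isomorphisms) for `ZilberClass`. [cite: Haykazyan2016, Definition 2] -/
theorem zilberClass_of_equiv_of_isZilberField (hK : IsZilberField K)
    (e : K ≃[Language.eclIso] H') : ZilberClass H' (fun X' => e '' ecl (e ⁻¹' X')) := by
  classical
  let E : H' ≃ K := e.toEquiv.symm
  letI iF' : Field H' := E.field
  let r : H' ≃+* K := E.ringEquiv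
  have hr : ∀ y, r y = E y := fun y => rfl
  have hrs : ∀ x, r.symm x = e x := fun x => rfl
  haveI iCZ' : CharZero H' := RingHom.charZero r.toRingHom
  letI iE' : ExponentialRing H' :=
    { exp := fun y => r.symm (ExponentialRing.exp (r y))
      exp_zero := by
        change r.symm (ExponentialRing.exp (r 0)) = 1
        rw [map_zero, ExponentialRing.exp_zero, map_one]
      exp_add := fun x y => by
        change r.symm (ExponentialRing.exp (r (x + y))) =
          r.symm (ExponentialRing.exp (r x)) * r.symm (ExponentialRing.exp (r y))
        rw [map_add, ExponentialRing.exp_add, map_mul] }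
  have hexp' : ∀ y : H', ExponentialRing.exp y = r.symm (ExponentialRing.exp (r y)) := fun y => rfl
  -- the isomorphism of exponential fields `K ≃ H'`
  let eE : ExponentialRingEquiv K H' :=
    { r.symm with
      map_exp' := fun x => by
        change r.symm (ExponentialRing.exp x) = ExponentialRing.exp (r.symm x)
        rw [hexp', RingEquiv.apply_symm_apply] }
  have heE : ∀ x, eE x = e x := fun x => rfl
  have heEfun : (⇑eE : K → H') = ⇑e := funext heE
  have hEe : ∀ y, e (E y) = y := fun y => e.toEquiv.apply_symm_apply y
  refine ⟨iF', iCZ', iE', IsZilberField.of_exponentialRingEquiv eE hK, ?_, ?_⟩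
  · -- the given structure is the canonical one of the transported exponential field
    refine structure_ext (fun f v => ?_) (fun R v => ?_)
    · -- function symbols: `funMap' f v = e (funMap f (E ∘ v))`
      have hv : ⇑e ∘ (⇑E ∘ v) = v := funext fun i => hEe (v i)
      have key := e.map_fun f (⇑E ∘ v)
      rw [hv] at key
      rw [← key]
      cases f with
      | add => rfl
      | mul => rfl
      | neg => rfl
      | zero => rfl
      | one => rfl
      | exp => rfl
    · -- relation symbols: both sides say `(ecl(v), v) ≅ R`
      have hv : ⇑e ∘ (⇑E ∘ v) = v := funext fun i => hEe (v i)
      have key := e.map_rel R (⇑E ∘ v)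
      rw [hv] at key
      rw [key, Language.eclIso.relMap_iff, Language.eclIso.relMap_iff]
      constructor
      · rintro ⟨φ', hφ', hφ't⟩
        refine ⟨eE.symm.toExponentialRingHom.comp φ', ?_, ?_⟩
        · have hsymm : ⇑eE.symm ∘ v = ⇑E ∘ v := funext fun i => by
            apply eE.injective
            change eE (eE.symm (v i)) = eE (E (v i))
            rw [ExponentialRingEquiv.apply_symm_apply, heE, hEe]
          change Set.range (⇑eE.symm ∘ ⇑φ') = _
          rw [Set.range_comp, hφ', Khovanskii.image_ecl_equiv, ← Set.range_comp, hsymm]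
        · funext i
          have hi := congr_fun hφ't i
          apply eE.injective
          change eE (eE.symm (φ' (R.pt i))) = eE (E (v i))
          rw [ExponentialRingEquiv.apply_symm_apply, heE, hEe]
          exact hi
      · rintro ⟨φ, hφ, hφt⟩
        refine ⟨eE.toExponentialRingHom.comp φ, ?_, ?_⟩
        · change Set.range (⇑eE ∘ ⇑φ) = _
          rw [Set.range_comp, hφ, Khovanskii.image_ecl_equiv, ← Set.range_comp, heEfun, hv]
        · funext i
          have hi := congr_fun hφt i
          change eE (φ (R.pt i)) = v i
          rw [show φ (R.pt i) = E (v i) from hi, heE, hEe]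
  · -- the transported closure is `ecl`
    funext X'
    rw [← heEfun, Khovanskii.image_ecl_equiv, heEfun, Set.image_preimage_eq X' e.surjective]

variable {H : Type} [Language.eclIso.Structure H] {cl : Set H → Set H}

/-- **Axiom (1) for the class of Zilber fields** (Haykazyan 2016, Def. 2, closure under
isomorphisms): the class `ZilberClass` is closed under `Language.eclIso`-isomorphisms, with the
closure transported as `X' ↦ e(cl(e⁻¹ X'))`. [cite: Haykazyan2016, Definition 2] -/
theorem ZilberClass.of_equiv (hH : ZilberClass H cl) (e : H ≃[Language.eclIso] H') :
    ZilberClass H' (fun X' => e '' cl (e ⁻¹' X')) := by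
  obtain ⟨iF, iCZ, iE, hZ, rfl, rfl⟩ := hH
  exact zilberClass_of_equiv_of_isZilberField hZ e

end Transport

/-! ### The dictionary: isomorphisms of closed E-subfields are partial embeddings -/

section Dictionary

variable {K : Type} [Field K] [ExponentialRing K] {K' : Type*} [Field K'] [ExponentialRing K']

/-- The inclusion of `ecl A` into `ecl B` when `ecl A ⊆ ecl B`, as a morphism of exponential
rings between the E-subfields. [folklore] -/
def Khovanskii.eclSubfield.inclusionE {K : Type*} [Field K] [ExponentialRing K] {A B : Set K}
    (h : ecl A ⊆ ecl B) : ExponentialRingHom (Khovanskii.eclSubfield A) (Khovanskii.eclSubfield B) where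
  toFun z := ⟨z, h z.2⟩
  map_one' := Subtype.ext rfl
  map_mul' _ _ := Subtype.ext rfl
  map_zero' := Subtype.ext rfl
  map_add' _ _ := Subtype.ext rfl
  map_exp' _ := Subtype.ext rfl

/-- The inclusion is the identity on coordinates. [folklore] -/
@[simp] theorem Khovanskii.eclSubfield.coe_inclusionE_apply {K : Type*} [Field K] [ExponentialRing K]
    {A B : Set K} (h : ecl A ⊆ ecl B) (z : Khovanskii.eclSubfield A) :
    ((Khovanskii.eclSubfield.inclusionE h z : Khovanskii.eclSubfield B) : K) = z := by
  -- (a term-mode `rfl` here sends the kernel down a slow unfolding path; spell the value out)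
  show ((⟨(z : K), h z.2⟩ : Khovanskii.eclSubfield B) : K) = z
  rfl

/-- **An embedding of exponential rings `φ : ecl(S) → K'` with `ecl`-closed image is a partial
`Language.eclIso`-embedding on `ecl(S)`**, for any map `g` that agrees with `φ` on `ecl S`: every
finite tuple `u` from `ecl S` has the same quantifier-free type as `φ u`, because `φ` restricts to an
isomorphism `ecl(u) ≅ ecl(φ u)` (`eqQFType₂_of_eHom`, `ecl_range_comp_eHom`). The other half of the
dictionary "partial embeddings between closed sets = isomorphisms of exponential fields"
(Kirby 2010, Prop. 3.5). [cite: Kirby2010QMEC, Prop. 3.5] -/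
theorem isPartialEmbOn_ecl_of_eHom {S : Set K} {S' : Set K'}
    (φ : ExponentialRingHom (Khovanskii.eclSubfield S) K') (hφ : Set.range φ = ecl S') {g : K → K'}
    (hg : ∀ z : Khovanskii.eclSubfield S, g z = φ z) :
    IsPartialEmbOn Language.eclIso g (ecl S) := by
  intro n u hu
  let u₀ : Fin n → Khovanskii.eclSubfield S := fun i => ⟨u i, hu i⟩
  have hsub : ecl (Set.range u) ⊆ ecl S := by
    have h1 : Set.range u ⊆ ecl S := by rintro _ ⟨i, rfl⟩; exact hu i
    have := ecl_mono (K := K) h1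
    rwa [Khovanskii.ecl_ecl] at this
  let ψ : ExponentialRingHom (Khovanskii.eclSubfield (Set.range u)) K' :=
    φ.comp (Khovanskii.eclSubfield.inclusionE hsub)
  refine eqQFType₂_of_eHom ψ ?_ (fun i => ?_)
  · -- `range ψ = φ(ecl^{ecl S}(u₀)) = ecl(φ u₀) = ecl(g u)`
    have hgu : g ∘ u = ⇑φ ∘ u₀ := funext fun i => hg (u₀ i)
    rw [hgu, ecl_range_comp_eHom φ hφ u₀]
    ext b
    constructor
    · rintro ⟨z, rfl⟩
      refine ⟨Khovanskii.eclSubfield.inclusionE hsub z, ?_, rfl⟩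
      have hz : ((Khovanskii.eclSubfield.inclusionE hsub z : Khovanskii.eclSubfield S) : K) ∈
          ecl (Set.range (Subtype.val ∘ u₀)) := by
        rw [Khovanskii.eclSubfield.coe_inclusionE_apply]; exact z.2
      rw [ecl_range_comp_val] at hz
      obtain ⟨c, hc, hcz⟩ := hz
      rwa [← Subtype.ext hcz]
    · rintro ⟨c, hc, rfl⟩
      have hcu : (c : K) ∈ ecl (Set.range u) := by
        have : (c : K) ∈ Subtype.val '' ecl (Set.range u₀) := ⟨c, hc, rfl⟩
        rwa [← ecl_range_comp_val] at this
      exact ⟨⟨c, hcu⟩, congr_arg φ (Subtype.ext rfl)⟩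
  · change ψ ⟨u i, subset_ecl _ (Set.mem_range_self i)⟩ = g (u i)
    rw [show g (u i) = φ (u₀ i) from hg (u₀ i)]
    exact congr_arg φ (Subtype.ext rfl)

/-- **`ℵ₀`-homogeneity over `∅` inside closures, for exponential fields** (axiom (4ii) over `∅`
of Haykazyan's Def. 2 for `ZilberClass`, which in `Language.eclIso` is elementary): if
`qftp(x̄) = qftp(x̄')` and `y ∈ ecl(x̄)` then `qftp(x̄, y) = qftp(x̄', y')` for some `y'` — namely the
image of `y` under the isomorphism `ecl(x̄) ≅ ecl(x̄')` (and `ecl(x̄, y) = ecl(x̄)`).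
[cite: Haykazyan2016, Definition 2] -/
theorem exists_eqQFType₂_snoc_of_mem_ecl {n : ℕ} {x : Fin n → K} {x' : Fin n → K'}
    (h : Language.eclIso.EqQFType₂ x x') {y : K} (hy : y ∈ ecl (Set.range x)) :
    ∃ y' : K', Language.eclIso.EqQFType₂ (Fin.snoc x y : Fin (n + 1) → K) (Fin.snoc x' y') := by
  obtain ⟨φ, hφ, hφx⟩ := exists_eHom_of_eqQFType₂ h
  refine ⟨φ ⟨y, hy⟩, ?_⟩
  -- `ecl(x, y) = ecl(x)`
  have hrange : Set.range (Fin.snoc x y : Fin (n + 1) → K) = insert y (Set.range x) := Fin.range_snoc _ _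
  have hecl : ecl (Set.range (Fin.snoc x y : Fin (n + 1) → K)) = ecl (Set.range x) := by
    rw [hrange, ecl_insert_of_mem hy]
  have hy' : φ ⟨y, hy⟩ ∈ ecl (Set.range x') := hφ ▸ ⟨_, rfl⟩
  have hecl' : ecl (Set.range (Fin.snoc x' (φ ⟨y, hy⟩) : Fin (n + 1) → K')) = ecl (Set.range x') := by
    rw [Fin.range_snoc, ecl_insert_of_mem hy']
  let ψ : ExponentialRingHom (Khovanskii.eclSubfield (Set.range (Fin.snoc x y : Fin (n + 1) → K))) K' :=
    φ.comp (Khovanskii.eclSubfield.inclusionE hecl.subset)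
  have hψ : ∀ (z : K) (hz : z ∈ ecl (Set.range (Fin.snoc x y : Fin (n + 1) → K))),
      ψ ⟨z, hz⟩ = φ ⟨z, hecl.subset hz⟩ := fun _ _ => rfl
  refine eqQFType₂_of_eHom ψ ?_ (fun i => ?_)
  · rw [hecl']
    ext b
    constructor
    · rintro ⟨z, rfl⟩
      rw [← hφ]; exact ⟨_, rfl⟩
    · intro hb
      rw [← hφ] at hb
      obtain ⟨c, rfl⟩ := hb
      exact ⟨⟨c, hecl.symm.subset c.2⟩, congr_arg φ (Subtype.ext rfl)⟩
  · rw [hψ]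
    refine Fin.lastCases ?_ (fun j => ?_) i
    · conv_rhs => rw [Fin.snoc_last]
      exact congr_arg φ (Subtype.ext (by simp))
    · conv_rhs => rw [Fin.snoc_castSucc]
      rw [← hφx j]
      exact congr_arg φ (Subtype.ext (by simp))

end Dictionary

/-! ### Axiom (3ii) reduced to algebra: `ecl`-closed E-subfields as members -/

section ClosedSubfields

variable {K : Type} [Field K] [ExponentialRing K]

/-- The `ecl`-closed E-subfield `ecl X ≤ K` as a `Language.eclIso`-substructure (closed under
`+, ·, -, 0, 1, exp`: Kirby 2010 (EAEF), Lemma 3.3). [cite: Kirby2010, Lemma 3.3] -/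
def Language.eclIso.eclSubstructure (X : Set K) : Language.eclIso.Substructure K where
  carrier := ecl X
  fun_mem := by
    intro n f v hv
    cases f with
    | add => exact Khovanskii.add_mem_ecl (hv 0) (hv 1)
    | mul => exact Khovanskii.mul_mem_ecl (hv 0) (hv 1)
    | neg => exact Khovanskii.neg_mem_ecl (hv 0)
    | zero => exact Khovanskii.zero_mem_ecl X
    | one => exact Khovanskii.one_mem_ecl X
    | exp => exact Khovanskii.exp_mem_ecl (hv 0)

/-- The carrier of `eclSubstructure X` is `ecl X`. [folklore] -/
@[simp] theorem Language.eclIso.coe_eclSubstructure (X : Set K) :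
    ((Language.eclIso.eclSubstructure X : Language.eclIso.Substructure K) : Set K) = ecl X := rfl

/-- Inside the E-subfield `ecl X`, the closure of (the preimage of) `X` is everything. [folklore] -/
theorem ecl_preimage_val_eq_univ (X : Set K) :
    ecl (Subtype.val ⁻¹' X : Set (Khovanskii.eclSubfield X)) = Set.univ := by
  apply Set.eq_univ_of_forall
  intro z
  have h1 : Subtype.val '' (Subtype.val ⁻¹' X : Set (Khovanskii.eclSubfield X)) = X := by
    ext a
    constructor
    · rintro ⟨b, hb, rfl⟩; exact hb
    · intro ha; exact ⟨⟨a, subset_ecl _ ha⟩, ha, rfl⟩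
  have h2 : (z : K) ∈ ecl (Subtype.val '' (Subtype.val ⁻¹' X : Set (Khovanskii.eclSubfield X))) := by
    rw [h1]; exact z.2
  rw [← Khovanskii.eclSubfield.image_ecl] at h2
  obtain ⟨c, hc, hcz⟩ := h2
  rwa [← Subtype.ext hcz]

/-- **Closed subsets as members, reduced to algebra**: if the `ecl`-closed E-subfield `ecl X` of a
(characteristic-zero) exponential field `K` is a Zilber field, then the `Language.eclIso`-substructure
`ecl X` of `K`, with its induced structure and the restricted closure, is in `ZilberClass` — the
induced interpretation of the relation symbols agrees with the canonical one of the E-field `ecl X`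
(`relMap_comp_iff_of_eHom` for the identity of `ecl X`), and the restricted closure is the `ecl` of
the E-field `ecl X` (`Khovanskii.eclSubfield.image_ecl`). So axiom (3ii) of Haykazyan's Def. 2 for
`ZilberClass` is exactly "ecl-closed E-subfields of Zilber fields are Zilber fields" (Kirby 2010,
axiom I.2; Bays–Kirby 2013, Prop. 4). [cite: BaysKirby2013Excellence, Prop. 4 (axiom I.2)] -/
theorem zilberClass_eclSubstructure [CharZero K] (X : Set K)
    (hS : IsZilberField (Khovanskii.eclSubfield X)) :
    ZilberClass (Language.eclIso.eclSubstructure X) (restrictCl ecl (ecl X)) := by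
  -- the E-field structure of `ecl X`, on the (definitionally equal) substructure type
  let F := Khovanskii.eclSubfield X
  have hid : Set.range (ExponentialRingHom.id F) = ecl (Subtype.val ⁻¹' X : Set F) := by
    rw [ecl_preimage_val_eq_univ]
    exact Set.eq_univ_of_forall fun z => ⟨z, rfl⟩
  have hrel : ∀ {k : ℕ} (R : PointedEField k) (v : Fin k → F),
      Structure.RelMap (L := Language.eclIso) R v ↔
        Structure.RelMap (L := Language.eclIso) R (Subtype.val ∘ v) := fun R v =>
    (relMap_comp_iff_of_eHom (ExponentialRingHom.id F) hid R v).symm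
  have hcl : ∀ Y : Set F, (Subtype.val ⁻¹' ecl (Subtype.val '' Y) : Set F) = ecl Y := fun Y => by
    ext z
    rw [Set.mem_preimage, ← Khovanskii.eclSubfield.image_ecl]
    exact ⟨fun ⟨c, hc, hcz⟩ => by rwa [← Subtype.ext hcz], fun hz => ⟨z, hz, rfl⟩⟩
  refine ⟨(inferInstance : Field F), (inferInstance : CharZero F), (inferInstance : ExponentialRing F),
    hS, ?_, ?_⟩
  · refine structure_ext (fun f v => ?_) (fun R v => ?_)
    · cases f <;> rfl
    · exact hrel R v
  · funext Y
    exact hcl Y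

variable {H : Type} [Language.eclIso.Structure H] {cl : Set H → Set H}

/-- **Axiom (3ii) for the class of Zilber fields, from its algebraic core**: granted that
`ecl`-closed E-subfields of Zilber fields are Zilber fields (hypothesis `h`), every `cl X` of a member,
as a substructure with the restricted closure, is a member. [cite: BaysKirby2013Excellence, Prop. 4 (axiom I.2)] -/
theorem ZilberClass.cl_mem_of (h : ∀ {K : Type} [Field K] [CharZero K] [ExponentialRing K],
      IsZilberField K → ∀ X : Set K, IsZilberField (Khovanskii.eclSubfield X))
    (hH : ZilberClass H cl) (X : Set H) :
    ∃ S : Language.eclIso.Substructure H, (S : Set H) = cl X ∧ ZilberClass S (restrictCl cl (S : Set H)) := by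
  obtain ⟨iF, iCZ, iE, hZ, rfl, rfl⟩ := hH
  exact ⟨Language.eclIso.eclSubstructure X, rfl, zilberClass_eclSubstructure X (h hZ X)⟩

end ClosedSubfields

/-! ### Axiom (2) and axiom (4i) over `∅`, from the isomorphism of the `ecl(∅)`'s -/

section EclEmpty

variable {H H' : Type} [Language.eclIso.Structure H] [Language.eclIso.Structure H']
  {cl : Set H → Set H} {cl' : Set H' → Set H'}

/-- **Axiom (2) for the class of Zilber fields, from its algebraic core**: granted that the
`ecl(∅)`'s of any two Zilber fields are isomorphic as exponential fields (hypothesis `h`: an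
embedding `ecl^K(∅) → K'` with image `ecl^{K'}(∅)`; Kirby 2013 (FPEF), Cor. 6.10), any two members
satisfy the same quantifier-free `Language.eclIso`-sentences. [cite: Kirby2013FPEF, Cor. 6.10] -/
theorem ZilberClass.eqQFType₂_elim0_of
    (h : ∀ {K K' : Type} [Field K] [CharZero K] [ExponentialRing K] [Field K'] [CharZero K']
      [ExponentialRing K'], IsZilberField K → IsZilberField K' →
        ∃ φ : ExponentialRingHom (Khovanskii.eclSubfield (∅ : Set K)) K', Set.range φ = ecl ∅)
    (hH : ZilberClass H cl) (hH' : ZilberClass H' cl') :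
    Language.eclIso.EqQFType₂ (Fin.elim0 : Fin 0 → H) (Fin.elim0 : Fin 0 → H') := by
  obtain ⟨iF, iCZ, iE, hZ, rfl, rfl⟩ := hH
  obtain ⟨iF', iCZ', iE', hZ', rfl, rfl⟩ := hH'
  obtain ⟨φ, hφ⟩ := h hZ hZ'
  have h0 : Set.range (Fin.elim0 : Fin 0 → H) = ∅ := Set.range_eq_empty _
  have h0' : Set.range (Fin.elim0 : Fin 0 → H') = ∅ := Set.range_eq_empty _
  let ψ : ExponentialRingHom (Khovanskii.eclSubfield (Set.range (Fin.elim0 : Fin 0 → H))) H' :=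
    φ.comp (Khovanskii.eclSubfield.inclusionE (by rw [h0]))
  refine eqQFType₂_of_eHom ψ ?_ (fun i => i.elim0)
  rw [h0']
  ext b
  constructor
  · rintro ⟨z, rfl⟩; rw [← hφ]; exact ⟨_, rfl⟩
  · intro hb
    rw [← hφ] at hb
    obtain ⟨c, rfl⟩ := hb
    exact ⟨⟨c, by rw [h0]; exact c.2⟩, congr_arg φ (Subtype.ext rfl)⟩

/-- **Axiom (4i) over `∅` follows from axioms (2) and (4i) over closed sets**: granted the
isomorphism of the `ecl(∅)`'s (`h₂`, as in `ZilberClass.eqQFType₂_elim0_of`) and the uniqueness of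
the generic type over countable closed subsets (`h₄`, axiom (4i) closed case), points outside
`ecl(∅)` in two members have the same quantifier-free type: apply `h₄` over the countable closed
`G = ecl(∅)` along the isomorphism `ecl^H(∅) ≅ ecl^{H'}(∅)` (a partial embedding on `G`,
`isPartialEmbOn_ecl_of_eHom`) and restrict to the empty tuple of parameters.
[cite: Haykazyan2016, Definition 2] -/
theorem ZilberClass.eqQFType₂_of_notMem_cl_empty_of
    (h₂ : ∀ {K K' : Type} [Field K] [CharZero K] [ExponentialRing K] [Field K'] [CharZero K']
      [ExponentialRing K'], IsZilberField K → IsZilberField K' →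
        ∃ φ : ExponentialRingHom (Khovanskii.eclSubfield (∅ : Set K)) K', Set.range φ = ecl ∅)
    (h₄ : ∀ {H H' : Type} [Language.eclIso.Structure H] [Language.eclIso.Structure H']
      {cl : Set H → Set H} {cl' : Set H' → Set H'}, ZilberClass H cl → ZilberClass H' cl' →
        ∀ (G : Set H) (g : H → H'), G.Countable → cl G = G → cl' (g '' G) = g '' G →
          IsPartialEmbOn Language.eclIso g G → ∀ ⦃x : H⦄ ⦃x' : H'⦄, x ∉ cl G → x' ∉ cl' (g '' G) →
            Language.eclIso.EqQFTypeOver₂ G g ![x] ![x'])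
    (hH : ZilberClass H cl) (hH' : ZilberClass H' cl') ⦃x : H⦄ ⦃x' : H'⦄ (hx : x ∉ cl ∅)
    (hx' : x' ∉ cl' ∅) : Language.eclIso.EqQFType₂ ![x] ![x'] := by
  classical
  obtain ⟨iF, iCZ, iE, hZ, rfl, rfl⟩ := id hH
  obtain ⟨iF', iCZ', iE', hZ', rfl, rfl⟩ := id hH'
  obtain ⟨φ, hφ⟩ := h₂ hZ hZ'
  -- extend `φ` to a total map
  let g : H → H' := fun z => if hz : z ∈ ecl (∅ : Set H) then φ ⟨z, hz⟩ else x'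
  have hg : ∀ z : Khovanskii.eclSubfield (∅ : Set H), g z = φ z := fun z => by
    show (if hz : (z : H) ∈ ecl (∅ : Set H) then φ ⟨z, hz⟩ else x') = φ z
    rw [dif_pos (show (z : H) ∈ ecl (∅ : Set H) from z.2)]
  have hgemb : IsPartialEmbOn Language.eclIso g (ecl ∅) := isPartialEmbOn_ecl_of_eHom φ hφ hg
  have hgG : g '' ecl ∅ = ecl ∅ := by
    rw [← hφ]
    ext b
    constructor
    · rintro ⟨z, hz, rfl⟩; exact ⟨⟨z, hz⟩, (hg ⟨z, hz⟩).symm⟩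
    · rintro ⟨z, rfl⟩; exact ⟨z, z.2, hg z⟩
  have hGc : (ecl (∅ : Set H)).Countable := hZ.hasCountableClosureProperty ∅ Set.countable_empty
  have key := h₄ hH hH' (ecl ∅) g hGc (Khovanskii.ecl_ecl _) (by rw [hgG]; exact Khovanskii.ecl_ecl _)
    hgemb (x := x) (x' := x') (by rwa [Khovanskii.ecl_ecl]) (by rwa [hgG, Khovanskii.ecl_ecl])
  exact key.eqQFType₂

end EclEmpty

/-! ### Assembly: what remains of the class axioms -/

section Assembly

/-- **The class of Zilber fields is a quasiminimal pregeometry class, granted its deep clauses.**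
With axioms (1), (3i), (3iii) and (4ii) over `∅` proved above, and axioms (2), (3ii), (4i) over `∅`
reduced to their algebraic cores, Haykazyan's Def. 2 for `ZilberClass` in `Language.eclIso`
follows from the following printed results, taken here as hypotheses:

* `h₂` — the `ecl(∅)`'s of any two Zilber fields are isomorphic exponential fields (Kirby,
  *Finitely presented exponential fields*, Algebra & Number Theory 7 (2013), Cor. 6.10: countable
  models are classified by dimension; dimension `0`);
* `h₃` — `ecl`-closed E-subfields of Zilber fields are Zilber fields (Kirby 2010 axiom I.2 for the
  class; Zilber 2005 §5; Bays–Kirby 2013, Prop. 4);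
* `h₄₃`, `h₄₄` — `ℵ₀`-homogeneity over countable closed subsets, across two Zilber fields, in its
  two clauses: uniqueness of the generic type and extension inside closures (Kirby 2010 axiom II;
  Bays–Kirby 2013, Prop. 5; Kirby 2010, Thm 2.1 and Prop. 3.5).

[cite: BaysKirby2013Excellence, Props 4–5] [cite: Haykazyan2016, Definition 2] -/
theorem ZilberClass.isQuasiminimalPregeometryClass_of
    (h₂ : ∀ {K K' : Type} [Field K] [CharZero K] [ExponentialRing K] [Field K'] [CharZero K']
      [ExponentialRing K'], IsZilberField K → IsZilberField K' →
        ∃ φ : ExponentialRingHom (Khovanskii.eclSubfield (∅ : Set K)) K', Set.range φ = ecl ∅)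
    (h₃ : ∀ {K : Type} [Field K] [CharZero K] [ExponentialRing K],
      IsZilberField K → ∀ X : Set K, IsZilberField (Khovanskii.eclSubfield X))
    (h₄₃ : ∀ {H H' : Type} [Language.eclIso.Structure H] [Language.eclIso.Structure H']
      {cl : Set H → Set H} {cl' : Set H' → Set H'}, ZilberClass H cl → ZilberClass H' cl' →
        ∀ (G : Set H) (g : H → H'), G.Countable → cl G = G → cl' (g '' G) = g '' G →
          IsPartialEmbOn Language.eclIso g G → ∀ ⦃x : H⦄ ⦃x' : H'⦄, x ∉ cl G → x' ∉ cl' (g '' G) →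
            Language.eclIso.EqQFTypeOver₂ G g ![x] ![x'])
    (h₄₄ : ∀ {H H' : Type} [Language.eclIso.Structure H] [Language.eclIso.Structure H']
      {cl : Set H → Set H} {cl' : Set H' → Set H'}, ZilberClass H cl → ZilberClass H' cl' →
        ∀ (G : Set H) (g : H → H'), G.Countable → cl G = G → cl' (g '' G) = g '' G →
          ∀ ⦃n : ℕ⦄ (x : Fin n → H) (x' : Fin n → H'), Language.eclIso.EqQFTypeOver₂ G g x x' →
            ∀ ⦃y : H⦄, y ∈ cl (G ∪ Set.range x) →
              ∃ y' : H', Language.eclIso.EqQFTypeOver₂ G g (Fin.snoc x y : Fin (n + 1) → H)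
                (Fin.snoc x' y')) :
    IsQuasiminimalPregeometryClass Language.eclIso ZilberClass where
  of_equiv hH e := hH.of_equiv e
  eqQFType₂_elim0 hH hH' := ZilberClass.eqQFType₂_elim0_of h₂ hH hH'
  isPregeometry hH := hH.isPregeometry
  countable_cl hH := hH.countable_cl
  cl_mem hH := ZilberClass.cl_mem_of h₃ hH
  mem_cl_iff_of_isPartialEmbOn hH hH' := hH.mem_cl_iff_of_isPartialEmbOn hH'
  eqQFType₂_of_notMem_cl_empty hH hH' := ZilberClass.eqQFType₂_of_notMem_cl_empty_of h₂ h₄₃ hH hH'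
  exists_eqQFType₂_snoc hH hH' := by
    obtain ⟨iF, iCZ, iE, hZ, rfl, rfl⟩ := hH
    obtain ⟨iF', iCZ', iE', hZ', rfl, rfl⟩ := hH'
    intro n x x' hxx' y hy
    exact exists_eqQFType₂_snoc_of_mem_ecl hxx' hy
  eqQFTypeOver₂_of_notMem_of_closed hH hH' := h₄₃ hH hH'
  exists_eqQFTypeOver₂_snoc_of_closed hH hH' := h₄₄ hH hH'

end Assembly

end Literature.NumberTheory.Transcendental

end
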